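import Mathlib.LinearAlgebra.Matrix.NonsingularInverse
import Mathlib.LinearAlgebra.Matrix.Rank
import Mathlib.Data.Finset.Sups
import Mathlib.Data.Rat.Defs
import HarnessLib

/-!
# Marica–Schönheim in linear-algebra form: the containment matrix of a family against its difference family has full row rank

Support file for the master-family `F`-inequality programme (`prim-master-conj` gen 26; `--supports stmt-CriticalPhenomena-4575`;
memo `run/shared/lean/prim/prim-l12/prim-master-conj/POINTWISE.md` §27 (V4)).  No definition, no `sorry`, standard axioms.

THEOREM (`rank_subset_diffs_eq_card`, new).  For every finite family `A` of finite sets, the `A × (A \\ A)` matrix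
`U[a, e] = 𝟙[e ⊆ a]` (`A \\ A = {a \ a' : a, a' ∈ A}`, Mathlib's `Finset.diffs`) has rank `#A` over `ℚ`.  Since the rank is at most the
number of columns this contains the Marica–Schönheim inequality `#A ≤ #(A \\ A)` (Mathlib: `Finset.card_le_card_diffs`, there via the
four functions theorem); the rank statement is the one-class case of conjecture (LA) of `SahiMasterFamilyFInequalityAMSLinearForm`.

PROOF (a Möbius identity; ten lines on paper).  Let `D = A \\ A`.  The "zeta" matrix `Z_F[x, y] = 𝟙[y ⊆ x]` of any finite family `F`
has injective `mulVec` (look at a minimal-cardinality point of the support of a kernel vector), hence is invertible; so there is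
`h : D → ℚ` with `Σ_{e ∈ D, e ⊆ y} h e = 𝟙[y = ∅]` for every `y ∈ D` (`exists_zeta_mulVec_eq`).  For `a, a' ∈ A` the difference
`a' \ a` lies in `D`, and `e ⊆ a' \ a ⟺ e ⊆ a' ∧ e ∩ a = ∅`, whence the identity
`𝟙[a' ⊆ a] = 𝟙[a' \ a = ∅] = Σ_{e ∈ D} 𝟙[e ∩ a = ∅]·h(e)·𝟙[e ⊆ a']`, i.e. `Z_A = W · Uᵀ` with `W[a,e] = 𝟙[e ∩ a = ∅] h(e)`
(`zeta_eq_disjointWeight_mul_transpose`).  `Z_A` is invertible, so `#A = rank Z_A ≤ rank Uᵀ = rank U ≤ #A`. ∎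
(In the memo's language: `h` is the Möbius function `μ_D(∅, ·)` of the poset `(D, ⊆)`.)  [this work]
-/

namespace Summit.CriticalPhenomena.PercolationContinuityZ3.Theorems

namespace TwistedAD

open Finset Matrix
open scoped FinsetFamily

variable {α : Type*} [DecidableEq α]

/-- The zeta matrix `Z_F[x,y] = 𝟙[y ⊆ x]` of a finite family of finite sets has injective `mulVec`: if `Z_F v = 0` and `v ≠ 0`, evaluate
at a point of the support of `v` of minimal cardinality. [this work] -/
theorem zeta_mulVec_injective (F : Finset (Finset α)) :
    Function.Injective (Matrix.of fun (x y : ↥F) => if (y : Finset α) ⊆ (x : Finset α) then (1 : ℚ) else 0).mulVec := by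
  set Z : Matrix ↥F ↥F ℚ := Matrix.of fun (x y : ↥F) => if (y : Finset α) ⊆ (x : Finset α) then (1 : ℚ) else 0 with hZ
  -- it suffices to show that the kernel is trivial
  suffices hker : ∀ u : ↥F → ℚ, Z.mulVec u = 0 → u = 0 by
    intro v w hvw
    have h0 : Z.mulVec (v - w) = 0 := by rw [Matrix.mulVec_sub, hvw, sub_self]
    exact sub_eq_zero.1 (hker _ h0)
  intro u hu
  by_contra hne
  have hsupp : (univ.filter fun y : ↥F => u y ≠ 0).Nonempty := by
    by_contra hemp
    rw [Finset.not_nonempty_iff_eq_empty] at hemp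
    apply hne
    funext y
    by_contra hy
    have : y ∈ univ.filter fun y : ↥F => u y ≠ 0 := mem_filter.2 ⟨mem_univ _, hy⟩
    rw [hemp] at this
    exact absurd this (Finset.notMem_empty _)
  obtain ⟨y₀, hy₀, hmin⟩ := Finset.exists_min_image _ (fun y : ↥F => (y : Finset α).card) hsupp
  have hy₀ne : u y₀ ≠ 0 := (mem_filter.1 hy₀).2
  -- evaluate `Z u` at `y₀`
  have heval : Z.mulVec u y₀ = u y₀ := by
    rw [Matrix.mulVec, dotProduct]
    rw [Finset.sum_eq_single y₀]
    · simp [hZ]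
    · intro y _ hyne
      simp only [hZ, Matrix.of_apply]
      by_cases hsub : (y : Finset α) ⊆ (y₀ : Finset α)
      · -- `y ⊊ y₀`, so `card y < card y₀` and `u y = 0` by minimality
        have hss : (y : Finset α) ⊂ (y₀ : Finset α) :=
          lt_of_le_of_ne hsub (fun h => hyne (Subtype.ext h))
        have hlt : (y : Finset α).card < (y₀ : Finset α).card := card_lt_card hss
        have huy : u y = 0 := by
          by_contra huy
          have := hmin y (mem_filter.2 ⟨mem_univ _, huy⟩)
          omega
        rw [huy, mul_zero]
      · rw [if_neg hsub, zero_mul]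
    · intro h; exact absurd (mem_univ y₀) h
  rw [hu] at heval
  exact hy₀ne (by rw [← heval]; rfl)

/-- Triangular solve: for every target `g` there is `h : F → ℚ` with `Σ_{e ∈ F, e ⊆ y} h e = g y` for all `y ∈ F`
(the zeta matrix is invertible). [this work] -/
theorem exists_zeta_mulVec_eq (F : Finset (Finset α)) (g : ↥F → ℚ) :
    ∃ h : ↥F → ℚ, (Matrix.of fun (x y : ↥F) => if (y : Finset α) ⊆ (x : Finset α) then (1 : ℚ) else 0).mulVec h = g :=
  (Matrix.mulVec_surjective_iff_isUnit.2 (Matrix.mulVec_injective_iff_isUnit.1 (zeta_mulVec_injective F))) g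

/-- **The Möbius identity behind Marica–Schönheim.**  For a family `A` let `D = A \\ A` and let `h : D → ℚ` solve
`Σ_{e ∈ D, e ⊆ y} h e = 𝟙[y = ∅]` (`y ∈ D`).  Then for all `a, a' ∈ A`:
`𝟙[a' ⊆ a] = Σ_{e ∈ D} 𝟙[e ∩ a = ∅]·h e·𝟙[e ⊆ a']`, i.e. `Z_A = W · Uᵀ`. [this work] -/
theorem zeta_eq_disjointWeight_mul_transpose (A : Finset (Finset α)) (h : ↥(A \\ A) → ℚ)
    (hh : (Matrix.of fun (x y : ↥(A \\ A)) => if (y : Finset α) ⊆ (x : Finset α) then (1 : ℚ) else 0).mulVec h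
      = fun y : ↥(A \\ A) => if (y : Finset α) = ∅ then (1 : ℚ) else 0) :
    (Matrix.of fun (a a' : ↥A) => if (a' : Finset α) ⊆ (a : Finset α) then (1 : ℚ) else 0)
      = (Matrix.of fun (a : ↥A) (e : ↥(A \\ A)) => if Disjoint (e : Finset α) (a : Finset α) then h e else 0)
        * (Matrix.of fun (a : ↥A) (e : ↥(A \\ A)) => if (e : Finset α) ⊆ (a : Finset α) then (1 : ℚ) else 0)ᵀ := by
  ext a a'
  have hmem : (a' : Finset α) \ (a : Finset α) ∈ A \\ A := mem_diffs.2 ⟨a', a'.2, a, a.2, rfl⟩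
  -- the solved equation at the point `a' \ a ∈ D`
  have key := congrFun hh ⟨(a' : Finset α) \ a, hmem⟩
  simp only [Matrix.mulVec, dotProduct, Matrix.of_apply] at key
  rw [Matrix.mul_apply]
  simp only [Matrix.of_apply, Matrix.transpose_apply]
  -- rewrite the target entry `𝟙[a' ⊆ a]` as `𝟙[a' \ a = ∅]` and use `key`
  have hiff : ((a' : Finset α) ⊆ (a : Finset α)) ↔ ((a' : Finset α) \ a = ∅) := sdiff_eq_empty_iff_subset.symm
  rw [show (if (a' : Finset α) ⊆ (a : Finset α) then (1 : ℚ) else 0) = (if (a' : Finset α) \ a = ∅ then (1 : ℚ) else 0) by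
    by_cases hs : (a' : Finset α) ⊆ (a : Finset α)
    · rw [if_pos hs, if_pos (hiff.1 hs)]
    · rw [if_neg hs, if_neg (fun h' => hs (hiff.2 h'))]]
  rw [← key]
  refine sum_congr rfl fun e _ => ?_
  -- `e ⊆ a' \ a ⟺ e ⊆ a' ∧ Disjoint e a`
  by_cases hd : Disjoint (e : Finset α) (a : Finset α)
  · by_cases hs : (e : Finset α) ⊆ (a' : Finset α)
    · rw [if_pos hd, if_pos hs, if_pos (subset_sdiff.2 ⟨hs, hd⟩), mul_one, one_mul]
    · rw [if_pos hd, if_neg hs, if_neg (fun h' => hs (subset_sdiff.1 h').1), mul_zero, zero_mul]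
  · rw [if_neg hd, zero_mul, if_neg (fun h' => hd (subset_sdiff.1 h').2), zero_mul]

/-- **Marica–Schönheim, linear-algebra form** (one-class case of conjecture (LA); POINTWISE §27 (V4)).  For every finite family `A`
of finite sets, the containment matrix `U[a, e] = 𝟙[e ⊆ a]` (`a ∈ A`, `e ∈ A \\ A`) has rank exactly `#A` over `ℚ`. [this work] -/
theorem rank_subset_diffs_eq_card (A : Finset (Finset α)) :
    (Matrix.of fun (a : ↥A) (e : ↥(A \\ A)) => if (e : Finset α) ⊆ (a : Finset α) then (1 : ℚ) else 0).rank = A.card := by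
  classical
  set U : Matrix ↥A ↥(A \\ A) ℚ :=
    Matrix.of fun (a : ↥A) (e : ↥(A \\ A)) => if (e : Finset α) ⊆ (a : Finset α) then (1 : ℚ) else 0 with hU
  apply le_antisymm
  · exact (Matrix.rank_le_card_height U).trans (Fintype.card_coe A).le
  · -- the Möbius weight `h` and the factorisation `Z_A = W * Uᵀ`
    obtain ⟨h, hh⟩ := exists_zeta_mulVec_eq (A \\ A) (fun y : ↥(A \\ A) => if (y : Finset α) = ∅ then (1 : ℚ) else 0)
    set ZA : Matrix ↥A ↥A ℚ := Matrix.of fun (a a' : ↥A) => if (a' : Finset α) ⊆ (a : Finset α) then (1 : ℚ) else 0 with hZA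
    set W : Matrix ↥A ↥(A \\ A) ℚ :=
      Matrix.of fun (a : ↥A) (e : ↥(A \\ A)) => if Disjoint (e : Finset α) (a : Finset α) then h e else 0 with hW
    have hfact : ZA = W * Uᵀ := zeta_eq_disjointWeight_mul_transpose A h hh
    have hunit : IsUnit ZA := Matrix.mulVec_injective_iff_isUnit.1 (zeta_mulVec_injective A)
    have hrankZ : ZA.rank = Fintype.card ↥A := Matrix.rank_of_isUnit ZA hunit
    calc A.card = Fintype.card ↥A := (Fintype.card_coe A).symm
      _ = ZA.rank := hrankZ.symm
      _ = (W * Uᵀ).rank := by rw [hfact]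
      _ ≤ Uᵀ.rank := Matrix.rank_mul_le_right W Uᵀ
      _ = U.rank := Matrix.rank_transpose U

/-- **Marica–Schönheim** `#A ≤ #(A \\ A)` as a corollary of the rank statement (Mathlib's `Finset.card_le_card_diffs` proves it via the
four functions theorem; here: the rank of the containment matrix is at most its number of columns). [this work; Marica–Schönheim 1969] -/
theorem card_le_card_diffs_of_rank (A : Finset (Finset α)) : A.card ≤ (A \\ A).card := by
  have h := rank_subset_diffs_eq_card A
  have hw := Matrix.rank_le_card_width
    (Matrix.of fun (a : ↥A) (e : ↥(A \\ A)) => if (e : Finset α) ⊆ (a : Finset α) then (1 : ℚ) else 0)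
  rw [h, Fintype.card_coe] at hw
  exact hw

end TwistedAD

end Summit.CriticalPhenomena.PercolationContinuityZ3.Theorems
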